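import Summits.BirchSwinnertonDyer.Rank1Residual.ManinAdditive.NeronFLineDepth
import Literature.NumberTheory.EllipticCurves.HeckeOperators
import HarnessLib
import HarnessLib.Audit.Tags

/-!
# Candidates E-desc-35 / 36, the GIVEN row E-desc-37 and the support row `RamanujanDepthTransfer` (desc g5 rev 2b,
# MEMO-desc §22): the RAMANUJAN CUT at `3` — the Ramanujan endomorphism `R₃ = t_{1/3} + t_{2/3}`, the
# `R₃`-stable lattice `S^R`, the selector «large star at 3» — cell `bsd-f2-manin` (D-0131 (3) frontier: the Manin
# constant at additive primes). Sibling: `ConwayCut` (the 2-adic cut, same sketch) and `ConwayRamanujanCutEdges`.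

HONEST FRAMING. LENS = descent / visibility (planner `bsd-f2-manin-desc` g5; HOME
`run/shared/lean/pub/bsd-f2-manin/MEMO-desc.md` §22, rev 2). Source: HOME/desc/Sketch-desc-g5.lean rev 2b sha16
**4994638152e2a41a** (farm rc 0 · 0 sorries per desc and per refuter-1 §R53), its 3-adic part `section AtThree`
(sketch lines 276–421), copied VERBATIM (namespace `DescG5` ↦ `…ManinAdditive.RamanujanCut`) with exactly these
deviations, recorded at the declaration: (i) `@[conjecture]` on the two law rows and on the support row (nothing is
asserted); (ii) refuter-1 §R53 recommendation 1 — the guard `9 ∣ N →` added to `RamanujanDepthTransfer` and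
`(h9 : 9 ∣ N)` threaded through its two consequences; (iii) the print-status paragraph of `IsRamanujanNeronAtThree`
(refuter-1 §R53: genuinely conjectural at every `9 ∣ N`); (iv) two one-line docstrings added.

For `9 ∣ N` the translations `t_{j/3} : z ↦ z + j/3` normalise `Γ₀(N)`; the induced automorphisms of `X₀(N)` are
defined over `ℚ(ζ₃)` and Galois-conjugate, so their SUM `R₃ := t_{1/3} + t_{2/3}` is a `ℚ`-rational endomorphism
of `J₀(N)`, acting on `q`-expansions by `aₙ ↦ c₃(n) aₙ` (`c₃` = Ramanujan sum: `2` if `3 ∣ n`, `−1` otherwise;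
refuter-1 §R53 P1: scalar `= 1` at `k = 2`, rationality VERIFIED).  By the Néron mapping property the Néron lattice
`Λ` is `R₃`-stable, hence lies in the E-blind computable lattice `S^{R} := ramanujanStableLattice N` (the largest
sublattice of `S₂(Γ₀(N);ℤ)` stable under all `w_Q` and `R₃`; `Λ_le_ramanujanStableLattice`, stability passed as a
hypothesis).  `IsLargeStarAtThree W` = potentially good at `3` with `≥ 8` components = exactly Kodaira III* ∪ II*
(refuter-1 §R53: LEAK-FREE, contrast §R52).
THE ROWS (`@[conjecture]`, nothing asserted; census of record (BC5) HOME/desc/RAMANUJAN-rows-g5.txt +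
P3-rows-g5.txt, engine 0⁺⁺⁺ `conway_mini_r.py`, rev 2b: 31/31 optimal curves at the thirteen all-rational levels
`9 ∣ N ≤ 297`; MS-0 two-engine agreement on P3 rows 31/31 per desc g6 2026-08-28T08:18Z; `σ₃ := ord₃ deg φ −
ord₃ [e_f S^R : ℤ f] ∈ {0,1}`, `σ₃ = 1` exactly at 99c1, 288e1 (III*), 216c1, 216d1 (II*)): **E-desc-35
`ThreeStarDefectLaw`**, **E-desc-36 `RamanujanDefectLeOneAtThree`**; the GIVEN-datum predicate **E-desc-37
`IsRamanujanNeronAtThree Δ`**; the support row **`RamanujanDepthTransfer`** and desc's PROVED consequences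
`not_three_dvd_maninConstant_of_ramanujanDepth`, `not_three_dvd_maninConstant_of_smallTypeAtThree` (for the class
«not III*/II* at 3» the chain gives `3 ∤ c_E` with no table input, given E-desc-35 + GIVEN + transfer).
WHY THE CELL WANTS THEM (§22; crux C3 `ManinPrimeToThreeAtNine` stmt-BirchSwinnertonDyer-22968): the 3-adic twin of
the Conway cut — `σ₃ = 0` rows discharge `3 ∤ c_E` AND Lie saturation at `3` given E-desc-37; `σ₃ = 1` locates
the defect (with `c = 1`, Cremona: `E → J₀(N)` is NOT Lie-saturated at `3` for 216c1, 216d1, 288e1).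
Beyond-print theorem: no. BSD is not proved by this; Manin's conjecture is not proved by this.

NOT IN PRINT as statements (desc presearch §22; refuter-2 R-desc-10 NOT posted at filing): automorphism-forced
prime powers in `deg φ` are in print (Dummigan–Krishnamoorthy 2013, Watkins 2002 §4 — cite-only), the lattice laws
are not. REFUTER VERDICTS AT FILING (2026-08-28T08:28Z): REF1 §R53 (HOME/ref1/R53-ref1-desc-g5.md c6742c70ee41a6e6;
kernel HOME/ref1-C61-desc-g5-audit.lean b4de42f85e3d09e2; probes CLEAN): rows 35/36/37/transfer SURVIVE as typed
with the typing note folded here; REF2 PENDING. Filed by the cell typer (T-desc-10).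
-/

noncomputable section

open scoped MatrixGroups ModularForm

open CongruenceSubgroup WeierstrassCurve Literature.NumberTheory.EllipticCurves.ModularForms
  Literature.NumberTheory.DiophantineGeometry

namespace Summit.BirchSwinnertonDyer.Rank1Residual.ManinAdditive.RamanujanCut

/-! ### The 3-adic cut: the Ramanujan endomorphism `R₃ = t_{1/3} + t_{2/3}` (desc g5 rev 2, VERBATIM)

For `9 ∣ N` the translations `t_{j/3} : z ↦ z + j/3` normalise `Γ₀(N)`; the induced automorphisms of `X₀(N)`
are defined over `ℚ(ζ₃)` and Galois-conjugate, so their SUM `R₃ := t_{1/3} + t_{2/3}` is a `ℚ`-rational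
endomorphism of `J₀(N)`, acting on `q`-expansions by `aₙ ↦ c₃(n) aₙ` (`c₃` = Ramanujan sum: `2` if `3 ∣ n`,
`−1` otherwise).  By the Néron mapping property the Néron lattice `Λ` is `R₃`-stable, hence lies in the
E-blind computable lattice `S^{R} :=` the largest sublattice of `S₂(Γ₀(N);ℤ)` stable under all `w_Q` and `R₃`.
Census (engine 0⁺⁺⁺ `conway_mini_r.py`, HOME/desc/RAMANUJAN-rows-g5.txt; fifteen optimal curves at the seven
all-rational levels `9 ∣ N ≤ 300`, `4 ∣ N`): `σ₃ := ord₃ deg φ − ord₃ [e_f S^{R} : ℤ f] ∈ {0,1}`, and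
`σ₃ = 1` EXACTLY at 216c1, 216d1 (Kodaira II* at 3) and 288e1 (III* at 3) — each the `(−3)`-twist of a
`σ₃ = 0` optimal curve of the same level (216b1, 216a1 (IV); 288a1 (III)) with `deg φ` ratio `3` and EQUAL
`[e_f S^{R} : ℤ f]`; `σ₃ = 0` at the twelve curves of type II, III, IV, I₀*, Iₙ* at 3.  With `c = 1`
(Cremona) this certifies `ord₃ e₁ ≥ 1`: `E → J₀(N)` is NOT Lie-saturated at `3` for 216c1, 216d1, 288e1. -/

section AtThree

open scoped Classical

/-- `(3 j; 0 3) ∈ GL(2, ℚ)⁺` (determinant `9`), acting on `ℍ` as `z ↦ z + j/3`. -/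
def thirdTranslateGL (j : ℕ) : GL(2, ℚ)⁺ :=
  ⟨Matrix.GeneralLinearGroup.mkOfDetNeZero !![3, (j : ℚ); 0, 3] (by simp [Matrix.det_fin_two]),
    by simp [Matrix.det_fin_two]⟩

variable (N : ℕ) [NeZero N] (k : ℤ)

/-- The **Ramanujan endomorphism** `R₃ = t_{1/3} + t_{2/3}` on `S_k(Γ₀(N))`, `9 ∣ N`: on `q`-expansions
`aₙ ↦ c₃(n) aₙ`.  Typed like `halfTranslate` (`9^{1−k/2}` times the sum of the two double-coset operators;
each is a single coset when `9 ∣ N`).  Junk (a sum of genuine Hecke operators) if `9 ∤ N`. [folklore;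
Atkin–Lehner 1970 §4 (normaliser), Conway–Norton] -/
def ramanujanThree : CuspForm (Gamma0 N) k →ₗ[ℂ] CuspForm (Gamma0 N) k :=
  (((9 : ℝ) ^ (1 - (k : ℝ) / 2) : ℝ) : ℂ) •
    (cuspHeckeOperatorₗ (Gamma0 N) k (thirdTranslateGL 1) + cuspHeckeOperatorₗ (Gamma0 N) k (thirdTranslateGL 2))

variable {N k}

variable (N) in
/-- `S^{R}`, the **Ramanujan-stable lattice at 3**: the largest `ℤ`-submodule of `S₂(Γ₀(N); ℤ)` stable under
every Atkin–Lehner involution `w_{Q_p}` AND the Ramanujan endomorphism `R₃`.  Contains the Néron lattice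
unconditionally (for `9 ∣ N`). -/
def ramanujanStableLattice : Submodule ℤ (CuspForm (Gamma0 N) 2) :=
  sSup {M | M ≤ integralCuspForms0 N 2 ∧ (∀ p : ℕ, p.Prime → p ∣ N →
    M.map ((atkinLehnerInvolutionAt N 2 p).restrictScalars ℤ) ≤ M) ∧
    M.map ((ramanujanThree N 2).restrictScalars ℤ) ≤ M}

/-- `S^{R} ≤ S^{AL}`. (desc g5 VERBATIM.) -/
theorem ramanujanStableLattice_le_alStableLattice : ramanujanStableLattice N ≤ alStableLattice N :=
  sSup_le fun _ hM => le_sSup ⟨hM.1, hM.2.1⟩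

/-- `S^{R}` is integral. (desc g5 VERBATIM.) -/
theorem ramanujanStableLattice_le : ramanujanStableLattice N ≤ integralCuspForms0 N 2 :=
  ramanujanStableLattice_le_alStableLattice.trans alStableLattice_le

/-- **«Large star at 3»** (E-facing, local at 3, over Mathlib's `c₄`, `Δ` and the tree's conductor):
potentially good reduction at `3` (`v₃(j) ≥ 0`, i.e. `c₄ = 0 ∨ v₃(Δ) ≤ 3·v₃(c₄)`) with at least EIGHT
components on the minimal regular model, `v₃(Δ) + 1 − v₃(N) ≥ 8` (Ogg).  For a globally minimal `W` with
`9 ∣ N` this says exactly: Kodaira type III* or II* at `3` — NOT IV* (rev 2b: the first typing, `v₃(Δ) ≥ 9`,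
included IV* and died in-seat at 27a1 and 54a1, both IV* with `σ₃ = 0`; F-desc-LS9). -/
def IsLargeStarAtThree (W : WeierstrassCurve ℚ) [W.IsElliptic] : Prop :=
  (W.c₄ = 0 ∨ padicValRat 3 W.Δ ≤ 3 * padicValRat 3 W.c₄) ∧
    ((7 + padicValNat 3 (W.conductorNorm ℤ) : ℕ) : ℤ) ≤ padicValRat 3 W.Δ

/-- **E-desc-35 `ThreeStarDefectLaw`** (`9 ∣ N`, any `v₂(N)`):
`ord₃ [e_f S^{R} : ℤ f] + [III* or II* at 3] = ord₃ deg φ` — rev 2b census 31/31 optimal curves at the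
thirteen all-rational levels `9 ∣ N ≤ 297` (27, 36, 45, 54, 72, 90, 99, 108, 144, 180, 198, 216, 288; `σ₃ = 1`
exactly at 99c1 (III*), 288e1 (III*), 216c1, 216d1 (II*); IV* rows 27a1, 54a1 have `σ₃ = 0`).  RIVAL READING
(confounded on this census, as IV*-vs-irreducible was at `2`): `σ₃ = 1 ⟺` large (`v₃(Δ) ≥ 9`, pot. good) `∧
E(ℚ)[3] = 0` — the two IV* rows are exactly the large rows WITH a rational `3`-torsion point.  Why it might
fail / decider: a IV* curve at `3` with `E(ℚ)[3] = 0` and `3 ∣ deg φ`, or a III*/II* curve with rational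
`3`-torsion, at a level with non-rational newforms (D-desc-7c); an `I₄*` row tests the pot.-good clause.
VERBATIM HOME/desc/Sketch-desc-g5.lean 4994638152e2a41a `DescG5.ThreeStarDefectLaw` (nothing asserted).
REF1 §R53: SURVIVES as typed; selector `IsLargeStarAtThree` audited LEAK-FREE (= exactly III* ∪ II* at `3`); the
E-facing shadow «`9 ∣ N`, III*/II* optimal ⇒ `3 ∣ deg φ`» (kernel edge `three_dvd_modularDegree_of_threeStarDefectLaw`,
refuter-1 RB61.4, sibling Edges file) holds 85 747/85 747 + 1 833/1 833; a RIVAL reading (`σ₃ = 1` from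
`Λ⊗ℤ₃ ⊊ S^R⊗ℤ₃`, not from `e₁`) is NOT separable by tables (decider D-desc-7c); REF2: pending at filing.
[cite: AgasheRibetStein2012, Thm. 2.1 (shape only: congruence number vs modular degree; the 3-adic Ramanujan-lattice defect law is the cell's law E-desc-35, NOT in print — MEMO-desc §22; census 31/31)] -/
@[conjecture]
def ThreeStarDefectLaw : Prop :=
  ∀ (W : WeierstrassCurve ℚ) [W.IsElliptic] [W.IsGloballyMinimal] [NeZero (W.conductorNorm ℤ)]
    (D : ModularParametrizationData W (W.conductorNorm ℤ)),
    (∀ z ∈ D.L.lattice, ∃ w ∈ periodLattice D.f, z = D.c * w) →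
    (∀ (W' : WeierstrassCurve ℚ) [W'.IsElliptic]
        (D' : ModularParametrizationData W' (W.conductorNorm ℤ)),
        D'.f = D.f → D.modularDegree ≤ D'.modularDegree) →
    9 ∣ W.conductorNorm ℤ →
    padicValNat 3 (lineIndex (ramanujanStableLattice (W.conductorNorm ℤ)) D.f)
      + (if IsLargeStarAtThree W then 1 else 0) = padicValNat 3 D.modularDegree

/-- **E-desc-36 `RamanujanDefectLeOneAtThree`** (`9 ∣ N`; census 31/31, 13 levels): the 3-adic defect of the
Ramanujan-stable lattice on the optimal `f`-line is at most one — `ord₃ deg φ ≤ ord₃ [e_f S^{R} : ℤ f] + 1`.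
With the Néron containment this is the lattice shadow of `9 ∤ c_E · e₁`; why it might fail: `27 ∣ N` levels with
TWO independent `3`-adic cuts (`R₃` and an odd `w_{q}` with `q ≡ −1 (mod 3)`), none among the census levels.
VERBATIM HOME/desc/Sketch-desc-g5.lean 4994638152e2a41a `DescG5.RamanujanDefectLeOneAtThree` (nothing asserted).
REF1 §R53: SURVIVES (`≤`-shape, junk-safe as E-desc-32; probe CLEAN); REF2: pending at filing.
[cite: AgasheRibetStein2012, Thm. 2.1 (shape only: the one-factor bound for the Ramanujan-stable lattice at `3` is the cell's law E-desc-36, NOT in print — MEMO-desc §22; census 31/31, 13 levels)] -/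
@[conjecture]
def RamanujanDefectLeOneAtThree : Prop :=
  ∀ (W : WeierstrassCurve ℚ) [W.IsElliptic] [W.IsGloballyMinimal] [NeZero (W.conductorNorm ℤ)]
    (D : ModularParametrizationData W (W.conductorNorm ℤ)),
    (∀ z ∈ D.L.lattice, ∃ w ∈ periodLattice D.f, z = D.c * w) →
    (∀ (W' : WeierstrassCurve ℚ) [W'.IsElliptic]
        (D' : ModularParametrizationData W' (W.conductorNorm ℤ)),
        D'.f = D.f → D.modularDegree ≤ D'.modularDegree) →
    9 ∣ W.conductorNorm ℤ →
    padicValNat 3 D.modularDegree ≤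
      padicValNat 3 (lineIndex (ramanujanStableLattice (W.conductorNorm ℤ)) D.f) + 1

variable {N : ℕ} [NeZero N] {W : WeierstrassCurve ℚ} [W.IsElliptic]
  {D : ModularParametrizationData W N} (Δ : NeronFLineDatum W D)

/-- `Λ ≤ S^{R}` from `R₃`-stability of `Λ` (Néron mapping property for `R₃ ∈ End_ℚ J₀(N)`, `9 ∣ N`; printed,
passed as a hypothesis). -/
theorem Λ_le_ramanujanStableLattice
    (hR : Δ.Λ.map ((ramanujanThree N 2).restrictScalars ℤ) ≤ Δ.Λ) :
    Δ.Λ ≤ ramanujanStableLattice N :=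
  le_sSup ⟨Δ.Λ_le, Δ.map_atkinLehner_le, hR⟩

/-- GIVEN-datum predicate at `3` (E-desc-37, the analogue of `ConwayCut.IsConwayNeronAtTwo`; nothing asserted):
the Néron lattice is the Ramanujan-stable lattice up to index prime to `3`.  PRINT STATUS (refuter-1 §R53):
GENUINELY CONJECTURAL at every `9 ∣ N` — the Katz–Mazur component `(1,1)` of `X₀(9M)/𝔽₃` has multiplicity
`φ(3) = 2`, so the «integral at all cusps» description of `H⁰(X₀(N), Ω)` acquires a different/multiplicity
correction there; `R₃`- and `w₉`-stability of `Λ` ARE theorems on paper (`R₃ ∈ End_ℚ J₀(N)`: `t_{1/3}, t_{2/3}`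
are `Gal(ℚ(ζ₃)/ℚ)`-conjugate — desc's probe VERIFIED by refuter-1 §R53 P1), rational singularities at `p = 3`,
`v₃(N) = 2` hold (ČNS p. 4), but `Λ⊗ℤ₃ = S^R⊗ℤ₃` is proved by nobody; decider D-desc-7c (`N = 99, 171, 288`).
Teeth: refuter-1 RB61.3 `not_isRamanujanNeronAtThree_of_Λ_eq_bot` (sibling Edges file).
[cite: CesnaviciusNeururerSaha2023, Thm. 1.2 and p. 4 (shape only: the identification of the Néron lattice with the Ramanujan-stable lattice at 3 is the cell's GIVEN row E-desc-37, NOT in print — MEMO-desc §22)] -/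
def IsRamanujanNeronAtThree : Prop :=
  Δ.Λ ≤ ramanujanStableLattice N ∧
    ∀ g ∈ ramanujanStableLattice N, ∃ n : ℕ, ¬ 3 ∣ n ∧ (n : ℤ) • g ∈ Δ.Λ

/-- **Support statement `RamanujanDepthTransfer`** (lattice bookkeeping; a THEOREM-CANDIDATE, not proved here —
refuter-1 §R53 P7: TRUE on paper at `9 ∣ N` (`a₃ = 0 ⇒ R₃ f = −f ⇒ ℤf ≤ S^R`), prover-sized): if `9 ∣ N`, the
GIVEN row at `3` + full `3`-adic depth of `S^{R}` on the `f`-line ⇒ Néron congruence depth at `3`.  DEVIATION from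
the sketch (refuter-1 §R53 rec. 1, folded by the typer): the guard `9 ∣ N →` is added (at `9 ∤ N` the operator
`R₃` is a sum of genuine Hecke coset operators and the unguarded statement's truth is not settled). -/
@[conjecture]
def RamanujanDepthTransfer : Prop :=
  ∀ (N : ℕ) [NeZero N] (W : WeierstrassCurve ℚ) [W.IsElliptic] (D : ModularParametrizationData W N)
    (Δ : NeronFLineDatum W D), 9 ∣ N → IsRamanujanNeronAtThree Δ →
    padicValNat 3 (lineIndex (ramanujanStableLattice N) D.f) = padicValNat 3 D.modularDegree →
    lineIndex (ramanujanStableLattice N) D.f ≠ 0 → Δ.NeronCongruenceDepthAt 3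

/-- `3 ∤ c_E` from the GIVEN row at `3`, full Ramanujan depth, and the landed interface theorem. (desc g5, PROVED;
`h9 : 9 ∣ N` threaded per refuter-1 §R53 rec. 1.) -/
theorem not_three_dvd_maninConstant_of_ramanujanDepth (hT : RamanujanDepthTransfer) (h9 : 9 ∣ N)
    (hΛ : IsRamanujanNeronAtThree Δ)
    (hfull : padicValNat 3 (lineIndex (ramanujanStableLattice N) D.f) = padicValNat 3 D.modularDegree)
    (hfin : lineIndex (ramanujanStableLattice N) D.f ≠ 0) :
    ¬ (3 : ℤ) ∣ D.maninConstant :=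
  haveI : Fact (Nat.Prime 3) := ⟨Nat.prime_three⟩
  Δ.not_dvd_maninConstant_of_depth (hT N W D Δ h9 hΛ hfull hfin)

/-- … and the curves where the law says depth is NOT full (`σ₃ = 1`: II*/III* at 3) are exactly where, given
`c = 1`, the optimal parametrisation fails to be Lie-saturated at `3` — so for the complementary class the
chain gives `3 ∤ c_E` with no table input: -/
theorem not_three_dvd_maninConstant_of_smallTypeAtThree
    (hLaw : ThreeStarDefectLaw) (hT : RamanujanDepthTransfer)
    (W : WeierstrassCurve ℚ) [W.IsElliptic] [W.IsGloballyMinimal] [NeZero (W.conductorNorm ℤ)]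
    (D : ModularParametrizationData W (W.conductorNorm ℤ)) (Δ : NeronFLineDatum W D)
    (hL : ∀ z ∈ D.L.lattice, ∃ w ∈ periodLattice D.f, z = D.c * w)
    (hopt : ∀ (W' : WeierstrassCurve ℚ) [W'.IsElliptic]
        (D' : ModularParametrizationData W' (W.conductorNorm ℤ)),
        D'.f = D.f → D.modularDegree ≤ D'.modularDegree)
    (h9 : 9 ∣ W.conductorNorm ℤ) (hsmall : ¬ IsLargeStarAtThree W)
    (hΛ : IsRamanujanNeronAtThree Δ)
    (hfin : lineIndex (ramanujanStableLattice (W.conductorNorm ℤ)) D.f ≠ 0) :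
    ¬ (3 : ℤ) ∣ D.maninConstant := by
  have h := hLaw W D hL hopt h9
  rw [if_neg hsmall, add_zero] at h
  exact not_three_dvd_maninConstant_of_ramanujanDepth Δ hT h9 hΛ h hfin

/-! #### desc g6 «ENGINE MS-0» (MEMO-desc §23, HOME/desc/Sketch-desc-g6.lean rev 5, 81eaae2400f26838): the typings at `3`
#### after the level-297 and level-540 deciders — E-desc-42 `SmallTypeFullLawAtThree`, E-desc-43
#### `BigStarNoThreeTorsionDefectLaw`, E-desc-45 `ResidualRankDefectLawAtThree`, their vocabulary and Manin chain

HONEST FRAMING (second cluster, appended by the cell typer; the first cluster above is byte-identical).  The desc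
planner's blind modular-symbols engine MS-0 (every optimal newform with `9 ∣ N ≤ 612`, 257 f / 61 levels,
MS0-P3-rows-g6.tsv 8041ff10059418fa; agreement with g5 31/31 + 13/13 byte-identical) REFUTED two exact laws at
`3`: **E-desc-35 `ThreeStarDefectLaw` above (`σ₃ = [III* ∨ II*]`) at 297a1** (IV* at `3`, `E(ℚ)[3] = 0`,
`deg φ = 72`, `[e_f S^R : ℤ f] = 24`, `σ₃ = 1`; also 297c1, 405d1, 405e1) — the landed declaration stays (tree
files are append-only) as a FALSIFIED named row, and its consumer `not_three_dvd_maninConstant_of_smallTypeAtThree`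
stays a valid implication from a refuted hypothesis — and its g5 rival **E-desc-39 `ThreeTorsionStarDefectLaw`
(`σ₃ = [IV*/III*/II* ∧ E(ℚ)[3] = 0]`) at 540c1 / 540d1** (IV*, `E(ℚ)[3] = ℤ/3` through `Φ₃`, analytic rank 1:
`216 / 72` and `108 / 36`, `σ₃ = 1`; law said `0`), which is therefore NOT filed (desc g6 CLOSE-OUT 2026-08-28T09:28:40Z:
«do NOT swap 39 in; drop 35 + consumer and carry E-desc-42 + `IsBigStarAtThree` + `not_three_dvd_maninConstant_of_not_bigStar`;
43/44/45 only after R-desc-11»).  WHAT STANDS at `3` (MS-0): not-big ⇒ `σ₃ = 0` (**E-desc-42**, 211/211 optimal f),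
IV*/III*/II* ∧ `E(ℚ)[3] = 0` ⇒ `σ₃ = 1` (**E-desc-43**, 39/39), and a RESIDUAL CLASS {big star at `3` with rational
`3`-torsion} on which `σ₃` is not decided by the local type and the torsion (seven optimal members ≤ 612, split 5 : 2
along the analytic rank — **E-desc-45**, one-sided and THIN).  This cluster carries E-desc-42 (the exact `p = 3` analogue
of E-desc-40 at `2`), E-desc-43 (analogue of E-desc-41), E-desc-45 (the `p = 3` twin of E-desc-44), their vocabulary
`IsBigStarAtThree`, `HasRationalThreeTorsion`, `HasPointOfInfiniteOrder` (VERBATIM), the Manin chain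
`not_three_dvd_maninConstant_of_not_bigStar` (desc g6 VERBATIM with `h9` threaded into the landed
`not_three_dvd_maninConstant_of_ramanujanDepth`) and the kernel bookkeeping `threeTorsionStar_off_residual` (42 ∧ 43 =
the refuted E-desc-39 OFF the residual class).  REFUTER VERDICTS: **REF1 §R57 = R-desc-11 (2026-08-28T10:26:53Z; report
HOME/ref1/R57-ref1-desc-g6.md b201cde6d2933293; kernel HOME/ref1-C65-desc-g6-audit.lean c7af850baac8c93a; BC7 probes
10/10 CLEAN; ENGINE 2 = independent Tate + exact 2-division/E⁰ typing + ecdata, 0 mismatches on every E-facing column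
of MS0-P3-rows-g6 (257 f)): E-desc-42, 43, 45 SURVIVE** (42/43 census LAWS not in print; 45 thin — «not a law until the
4-digit levels are in», typed for the record).  REF2 placement pending.  bears_on: stmt-BirchSwinnertonDyer-22968 (C3,
the Manin constant at `3`).  Beyond-print theorem: no.  BSD is not proved by this; Manin's conjecture is not proved by
this. -/

section AtThreeG6

open scoped Classical

/-- Kodaira type IV*, III* or II* at `3`: potentially good reduction (`c₄ = 0 ∨ v₃(Δ) ≤ 3 v₃(c₄)`, i.e.
`v₃(j) ≥ 0`) with at least seven components, `v₃(Δ) ≥ v₃(N) + 6` (on a global minimal model; by Ogg's formula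
`m = v₃(Δ) + 1 − f ≥ 7`).  (g5's `IsLargeStarAtThree` above asked for eight components and excluded IV*; the
level-297 decider put IV* back.)  (desc g6 VERBATIM, Sketch-desc-g6.lean rev 5 :593–596.) -/
def IsBigStarAtThree (W : WeierstrassCurve ℚ) : Prop :=
  (W.c₄ = 0 ∨ padicValRat 3 W.Δ ≤ 3 * padicValRat 3 W.c₄) ∧
    ((padicValNat 3 (W.conductorNorm ℤ) + 6 : ℕ) : ℤ) ≤ padicValRat 3 W.Δ

/-- **Candidate E-desc-42 `SmallTypeFullLawAtThree` (cell bsd-f2-manin, desc g6 MEMO-desc §23; nothing asserted;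
MS-0 census 211 / 211 optimal newforms with `9 ∣ N ≤ 612`): an optimal curve whose Kodaira type at `3` is NOT
IV*/III*/II* (II, III, IV, I₀*, Iₙ* — potentially multiplicative or not) has FULL Ramanujan depth,
`ord₃ [e_f S^R : ℤ f] = ord₃ deg φ`** (any `v₂(N)`; every `v₃(N) ∈ {2,3,4,5}` in range).  The theorem-shaped half at
`3`, analogue of E-desc-40 at `2`; consequence mod the GIVEN row E-desc-37 + `RamanujanDepthTransfer`: `3 ∤ c_E`
with no table input (`not_three_dvd_maninConstant_of_not_bigStar`).  Why it might fail (desc): an Iₙ* curve at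
`27 ∣ N` with two independent `3`-adic cuts (`v₃(N) = 5` has few rows).  VERBATIM Sketch-desc-g6.lean rev 5 :625–635.  REF1 §R57: SURVIVES (LAW, not in print).
[cite: CesnaviciusNeururerSaha2023, Thm. 1.2 (shape only: the c-side bound `c ∣ deg φ · …`; the depth law `σ₃ = 0` off the big-star types is the cell's row E-desc-42, NOT in print — MEMO-desc §23)] -/
@[conjecture]
def SmallTypeFullLawAtThree : Prop :=
  ∀ (W : WeierstrassCurve ℚ) [W.IsElliptic] [W.IsGloballyMinimal] [NeZero (W.conductorNorm ℤ)]
    (D : ModularParametrizationData W (W.conductorNorm ℤ)),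
    (∀ z ∈ D.L.lattice, ∃ w ∈ periodLattice D.f, z = D.c * w) →
    (∀ (W' : WeierstrassCurve ℚ) [W'.IsElliptic]
        (D' : ModularParametrizationData W' (W.conductorNorm ℤ)),
        D'.f = D.f → D.modularDegree ≤ D'.modularDegree) →
    9 ∣ W.conductorNorm ℤ → ¬ IsBigStarAtThree W →
      padicValNat 3 (lineIndex (ramanujanStableLattice (W.conductorNorm ℤ)) D.f) =
        padicValNat 3 D.modularDegree

/-- desc g6: the Manin chain at `3` over the full-depth half E-desc-42 — every optimal curve at `9 ∣ N` whose type
at `3` is not IV*/III*/II* gets `3 ∤ c_E` from the GIVEN row at `3` (E-desc-37 `IsRamanujanNeronAtThree`) and the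
transfer statement, with no table input.  (desc g6 VERBATIM up to threading `h9` into the landed
`not_three_dvd_maninConstant_of_ramanujanDepth`; PROVED.) -/
theorem not_three_dvd_maninConstant_of_not_bigStar
    (hLaw : SmallTypeFullLawAtThree) (hT : RamanujanDepthTransfer)
    (W : WeierstrassCurve ℚ) [W.IsElliptic] [W.IsGloballyMinimal] [NeZero (W.conductorNorm ℤ)]
    (D : ModularParametrizationData W (W.conductorNorm ℤ)) (Δ : NeronFLineDatum W D)
    (hL : ∀ z ∈ D.L.lattice, ∃ w ∈ periodLattice D.f, z = D.c * w)
    (hopt : ∀ (W' : WeierstrassCurve ℚ) [W'.IsElliptic]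
        (D' : ModularParametrizationData W' (W.conductorNorm ℤ)),
        D'.f = D.f → D.modularDegree ≤ D'.modularDegree)
    (h9 : 9 ∣ W.conductorNorm ℤ) (hsmall : ¬ IsBigStarAtThree W)
    (hΛ : IsRamanujanNeronAtThree Δ)
    (hfin : lineIndex (ramanujanStableLattice (W.conductorNorm ℤ)) D.f ≠ 0) :
    ¬ (3 : ℤ) ∣ D.maninConstant :=
  not_three_dvd_maninConstant_of_ramanujanDepth Δ hT h9 hΛ (hLaw W D hL hopt h9 hsmall) hfin

/-- `E(ℚ)[3] ≠ 0`, over Mathlib's group law on nonsingular rational points. (desc g6 VERBATIM, :598–600.) -/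
def HasRationalThreeTorsion (W : WeierstrassCurve ℚ) : Prop :=
  ∃ P : W.toAffine.Point, P ≠ 0 ∧ (3 : ℕ) • P = 0

/-- `E(ℚ)` has a point of infinite order (algebraic rank `≥ 1`), over Mathlib's group law.  (desc g6 VERBATIM, :310–312;
prime-independent vocabulary, declared here once and imported by the `p = 2` laws file.) -/
def HasPointOfInfiniteOrder (W : WeierstrassCurve ℚ) : Prop :=
  ∃ P : W.toAffine.Point, ∀ n : ℕ, 0 < n → n • P ≠ 0

/-- **Candidate E-desc-43 `BigStarNoThreeTorsionDefectLaw` (cell bsd-f2-manin, desc g6 MEMO-desc §23; nothing asserted;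
`9 ∣ N`; the exact defect half at `3` outside the residual class, analogue of E-desc-41): Kodaira IV*, III* or II* at `3`
and `E(ℚ)[3] = 0` ⇒ `ord₃ [e_f S^R : ℤ f] + 1 = ord₃ deg φ`** (MS-0 census 39/39: every such optimal newform in range, II*
and III* never carrying 3-torsion there; IV* without 3-torsion: 297a1, 297c1, 405d1, 405e1, 459d1, 459e1, 459h1, …).
Given `3 ∤ c_E` (Cremona) each is a certified failure of Lie-saturation of `E → J₀(N)` at `3`.  Why it might fail (desc): a
II*/III* curve of large level whose defect is absorbed by an extra End-stable cut at `27 ∣ N`.  VERBATIM Sketch-desc-g6.lean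
rev 5 :642–652.  REF1 §R57: SURVIVES (LAW, not in print; twist-pair mechanism of MEMO-desc §22.11).
[cite: CesnaviciusNeururerSaha2023, Thm. 1.2 (shape only: the c-side bound; the exact defect law at the big-star types is the cell's row E-desc-43, NOT in print — MEMO-desc §23)] -/
@[conjecture]
def BigStarNoThreeTorsionDefectLaw : Prop :=
  ∀ (W : WeierstrassCurve ℚ) [W.IsElliptic] [W.IsGloballyMinimal] [NeZero (W.conductorNorm ℤ)]
    (D : ModularParametrizationData W (W.conductorNorm ℤ)),
    (∀ z ∈ D.L.lattice, ∃ w ∈ periodLattice D.f, z = D.c * w) →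
    (∀ (W' : WeierstrassCurve ℚ) [W'.IsElliptic]
        (D' : ModularParametrizationData W' (W.conductorNorm ℤ)),
        D'.f = D.f → D.modularDegree ≤ D'.modularDegree) →
    9 ∣ W.conductorNorm ℤ → IsBigStarAtThree W → ¬ HasRationalThreeTorsion W →
      padicValNat 3 (lineIndex (ramanujanStableLattice (W.conductorNorm ℤ)) D.f) + 1 =
        padicValNat 3 D.modularDegree

/-- **Candidate E-desc-45 `ResidualRankDefectLawAtThree` (cell bsd-f2-manin, desc g6 MEMO-desc §23; nothing asserted;
one-sided, THIN: the residual class at `3` = big star WITH rational 3-torsion has seven optimal members at `9 ∣ N ≤ 612` —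
27a1, 54a1, 270a1, 459f1, 594c1 (rank 0, `σ₃ = 0`) and 540c1, 540d1 (rank 1, `σ₃ = 1`)): on the residual class at `3` a
point of infinite order forces the Ramanujan defect, `ord₃ [e_f S^R : ℤ f] + 1 = ord₃ deg φ`.**  Typed for the record as
the `p = 3` twin of E-desc-44; desc: «not a law until the 4-digit levels are in».  VERBATIM Sketch-desc-g6.lean rev 5
:657–668.  REF1 §R57: SURVIVES (thin).
[cite: CesnaviciusNeururerSaha2023, Thm. 1.2 (shape only: the c-side bound; the rank-forces-defect row is the cell's E-desc-45, NOT in print — MEMO-desc §23)] -/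
@[conjecture]
def ResidualRankDefectLawAtThree : Prop :=
  ∀ (W : WeierstrassCurve ℚ) [W.IsElliptic] [W.IsGloballyMinimal] [NeZero (W.conductorNorm ℤ)]
    (D : ModularParametrizationData W (W.conductorNorm ℤ)),
    (∀ z ∈ D.L.lattice, ∃ w ∈ periodLattice D.f, z = D.c * w) →
    (∀ (W' : WeierstrassCurve ℚ) [W'.IsElliptic]
        (D' : ModularParametrizationData W' (W.conductorNorm ℤ)),
        D'.f = D.f → D.modularDegree ≤ D'.modularDegree) →
    9 ∣ W.conductorNorm ℤ → IsBigStarAtThree W → HasRationalThreeTorsion W → HasPointOfInfiniteOrder W →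
      padicValNat 3 (lineIndex (ramanujanStableLattice (W.conductorNorm ℤ)) D.f) + 1 =
        padicValNat 3 D.modularDegree

/-- E-desc-42 and E-desc-43 together are exactly the refuted E-desc-39 (`σ₃ = [IV*/III*/II* at 3 ∧ E(ℚ)[3] = 0]`, killed
at 540c1/540d1 and never filed) OFF the residual class at `3` (big star WITH rational 3-torsion): the bookkeeping,
kernel-checked.  (desc g6 VERBATIM, :686–704; PROVED.) -/
theorem threeTorsionStar_off_residual
    (h42 : SmallTypeFullLawAtThree) (h43 : BigStarNoThreeTorsionDefectLaw)
    (W : WeierstrassCurve ℚ) [W.IsElliptic] [W.IsGloballyMinimal] [NeZero (W.conductorNorm ℤ)]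
    (D : ModularParametrizationData W (W.conductorNorm ℤ))
    (hL : ∀ z ∈ D.L.lattice, ∃ w ∈ periodLattice D.f, z = D.c * w)
    (hopt : ∀ (W' : WeierstrassCurve ℚ) [W'.IsElliptic]
        (D' : ModularParametrizationData W' (W.conductorNorm ℤ)),
        D'.f = D.f → D.modularDegree ≤ D'.modularDegree)
    (h9 : 9 ∣ W.conductorNorm ℤ) (hres : ¬ (IsBigStarAtThree W ∧ HasRationalThreeTorsion W)) :
    padicValNat 3 (lineIndex (ramanujanStableLattice (W.conductorNorm ℤ)) D.f) +
        (if IsBigStarAtThree W ∧ ¬ HasRationalThreeTorsion W then 1 else 0) =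
      padicValNat 3 D.modularDegree := by
  by_cases hb : IsBigStarAtThree W
  · have hnt : ¬ HasRationalThreeTorsion W := fun ht => hres ⟨hb, ht⟩
    rw [if_pos ⟨hb, hnt⟩]
    exact h43 W D hL hopt h9 hb hnt
  · have : ¬ (IsBigStarAtThree W ∧ ¬ HasRationalThreeTorsion W) := fun h => hb h.1
    rw [if_neg this, add_zero]
    exact h42 W D hL hopt h9 hb

/-- `IsLargeStarAtThree` (g5: III*/II*, eight components) implies `IsBigStarAtThree` (g6: seven components):
the g6 class enlarges the g5 class by IV*. (PROVED, arithmetic on the component bound.) -/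
theorem isBigStarAtThree_of_isLargeStarAtThree (W : WeierstrassCurve ℚ) [W.IsElliptic]
    (h : IsLargeStarAtThree W) : IsBigStarAtThree W := by
  obtain ⟨hpot, hcomp⟩ := h
  refine ⟨hpot, le_trans ?_ hcomp⟩
  push_cast
  linarith

end AtThreeG6

end AtThree

end Summit.BirchSwinnertonDyer.Rank1Residual.ManinAdditive.RamanujanCut
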